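import Summits.PneNP.PneNP.Theorems.BruckRyserSosSosBlindPlanesGrid
import Summits.PneNP.PneNP.Theorems.BruckRyserSosSosBlindPlanesCounting

/-!
# PneNP / BruckRyserSos — the template-sum formula (sums of invariant functions of configurations)

Route `PneNP/BruckRyserSos`, crux stmt-PneNP-16761 (`SosBlindPlanes`), fourth file.

**Template-sum formula** (`sum_eq_templateSum`). Let `F` be a real function of `j`-tuples of
configurations with at most `h` cells on the `v × v` board, invariant under the board symmetry
group `S_v × S_v`, and let `j h ≤ N ≤ v`, `0 < N`. Then
`Σ_x F x = Σ_ω F (ι ω) · (C(v,a_ω) / C(N,a_ω)) · (C(v,b_ω) / C(N,b_ω))`,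
the sum on the right running over `j`-tuples `ω` of configurations of the FIXED `N × N` template
board (`ι` the standard embedding, `a_ω`, `b_ω` the numbers of points and lines `ω` mentions).
So such a sum is a polynomial in `v` whose shape does not depend on `v` — the uniformity that
makes the degree-`d` moment problem of the plane system a first-order condition on the order
(file `…Formula`). Proof: double counting of `Σ_{g ∈ S_v × S_v} Σ_ω F (g · ι ω) c_ω`; the fibre
over a board tuple `x` has `κ(a_x) κ(b_x)` elements, `κ(a) = C(N,a) · a! · (v - a)!` being the
number of permutations moving a given `a`-set into the grid (`Relabel.card_perm_image_subset`).

References: folklore (Burnside-type double counting); P. J. Cameron, *Permutation Groups* (1999),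
§2 (orbit counting).
-/

set_option linter.dupNamespace false -- `Summit.PneNP.PneNP.…`: summit = sub-problem name (D-0017 single-conjunct layout)

noncomputable section

namespace Summit.PneNP.PneNP.Theorems.SosBlindPlanes

open Finset Function

variable {v N h j : ℕ}

/-! ### Tuples of configurations: support, action, embedding -/

/-- Embedding of template-board index configurations into the board. [folklore] -/
def embIdx (hNv : N ≤ v) (S : Idx N h) : Idx v h :=
  ⟨rel (emb hNv) (emb hNv) S.1, by
    rw [card_rel (emb_injective hNv).injOn (emb_injective hNv).injOn]; exact S.2⟩

/-- The underlying configuration of an embedded index. [folklore] -/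
@[simp] theorem embIdx_val (hNv : N ≤ v) (S : Idx N h) :
    (embIdx hNv S).1 = rel (emb hNv) (emb hNv) S.1 := rfl

/-- `down` undoes the grid embedding on configurations. [folklore] -/
theorem rel_down_emb (hN : 0 < N) (hNv : N ≤ v) (W : Finset (Fin N × Fin N)) :
    rel (down hN) (down hN) (rel (emb hNv) (emb hNv) W) = W :=
  rel_rel_eq_self (fun p _ => down_emb hN hNv p) (fun q _ => down_emb hN hNv q)

/-- The embedding of indices is injective. [folklore] -/
theorem embIdx_injective (hN : 0 < N) (hNv : N ≤ v) :
    Function.Injective (embIdx (h := h) hNv) := by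
  intro S T hST
  apply Subtype.ext
  have := congrArg Subtype.val hST
  simp only [embIdx_val] at this
  rw [← rel_down_emb hN hNv S.1, this, rel_down_emb hN hNv]

/-- The points mentioned by a tuple of configurations. [folklore] -/
def suppP {m : ℕ} (x : Fin j → Idx m h) : Finset (Fin m) :=
  univ.biUnion fun i => pts (x i).1

/-- The lines mentioned by a tuple of configurations. [folklore] -/
def suppL {m : ℕ} (x : Fin j → Idx m h) : Finset (Fin m) :=
  univ.biUnion fun i => lns (x i).1

/-- A `j`-tuple of configurations with at most `h` cells mentions at most `j h` points. [folklore] -/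
theorem card_suppP_le {m : ℕ} (x : Fin j → Idx m h) : (suppP x).card ≤ j * h := by
  refine card_biUnion_le.trans ?_
  calc ∑ i : Fin j, (pts (x i).1).card ≤ ∑ _i : Fin j, h :=
        sum_le_sum fun i _ => (card_pts_le _).trans (x i).2
    _ = j * h := by simp

/-- A `j`-tuple of configurations with at most `h` cells mentions at most `j h` lines. [folklore] -/
theorem card_suppL_le {m : ℕ} (x : Fin j → Idx m h) : (suppL x).card ≤ j * h := by
  refine card_biUnion_le.trans ?_
  calc ∑ i : Fin j, (lns (x i).1).card ≤ ∑ _i : Fin j, h :=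
        sum_le_sum fun i _ => (card_lns_le _).trans (x i).2
    _ = j * h := by simp

/-- Points of a tuple after the action. [folklore] -/
theorem suppP_act (σ τ : Equiv.Perm (Fin v)) (x : Fin j → Idx v h) :
    suppP (fun i => act σ τ (x i)) = (suppP x).image σ := by
  simp only [suppP, act_val, pts_rel]
  exact biUnion_image.symm

/-- Lines of a tuple after the action. [folklore] -/
theorem suppL_act (σ τ : Equiv.Perm (Fin v)) (x : Fin j → Idx v h) :
    suppL (fun i => act σ τ (x i)) = (suppL x).image τ := by
  simp only [suppL, act_val, lns_rel]
  exact biUnion_image.symm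

/-- Points of an embedded tuple. [folklore] -/
theorem suppP_emb (hNv : N ≤ v) (ω : Fin j → Idx N h) :
    suppP (fun i => embIdx hNv (ω i)) = (suppP ω).image (emb hNv) := by
  simp only [suppP, embIdx_val, pts_rel]
  exact biUnion_image.symm

/-- Lines of an embedded tuple. [folklore] -/
theorem suppL_emb (hNv : N ≤ v) (ω : Fin j → Idx N h) :
    suppL (fun i => embIdx hNv (ω i)) = (suppL ω).image (emb hNv) := by
  simp only [suppL, embIdx_val, lns_rel]
  exact biUnion_image.symm

/-- Embedding of a tuple of template configurations into the board. [folklore] -/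
def embT (hNv : N ≤ v) (ω : Fin j → Idx N h) : Fin j → Idx v h :=
  fun i => embIdx hNv (ω i)

/-- The action of the board symmetry group on tuples of configurations. [folklore] -/
def actT (g : Equiv.Perm (Fin v) × Equiv.Perm (Fin v)) (x : Fin j → Idx v h) : Fin j → Idx v h :=
  fun i => act g.1 g.2 (x i)

/-- Components of an embedded tuple. [folklore] -/
theorem embT_apply (hNv : N ≤ v) (ω : Fin j → Idx N h) (i : Fin j) :
    embT hNv ω i = embIdx hNv (ω i) := rfl

/-- Components of a tuple after the action. [folklore] -/
theorem actT_apply (g : Equiv.Perm (Fin v) × Equiv.Perm (Fin v)) (x : Fin j → Idx v h) (i : Fin j) :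
    actT g x i = act g.1 g.2 (x i) := rfl

/-- The action on tuples is multiplicative. [folklore] -/
theorem actT_mul (g g' : Equiv.Perm (Fin v) × Equiv.Perm (Fin v)) (x : Fin j → Idx v h) :
    actT g (actT g' x) = actT (g * g') x := by
  funext i
  simp only [actT_apply, Prod.fst_mul, Prod.snd_mul, act_act]

/-- The identity acts trivially on tuples. [folklore] -/
theorem actT_one (x : Fin j → Idx v h) : actT (1 : Equiv.Perm (Fin v) × Equiv.Perm (Fin v)) x = x := by
  funext i
  simp only [actT_apply, Prod.fst_one, Prod.snd_one, act_one]

/-- `g⁻¹` undoes `g` on tuples. [folklore] -/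
theorem actT_inv_actT (g : Equiv.Perm (Fin v) × Equiv.Perm (Fin v)) (x : Fin j → Idx v h) :
    actT g⁻¹ (actT g x) = x := by
  rw [actT_mul, inv_mul_cancel, actT_one]

/-- `g` undoes `g⁻¹` on tuples. [folklore] -/
theorem actT_actT_inv (g : Equiv.Perm (Fin v) × Equiv.Perm (Fin v)) (x : Fin j → Idx v h) :
    actT g (actT g⁻¹ x) = x := by
  rw [actT_mul, mul_inv_cancel, actT_one]

/-- The embedding of tuples is injective. [folklore] -/
theorem embT_injective (hN : 0 < N) (hNv : N ≤ v) : Function.Injective (embT (j := j) (h := h) hNv) := by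
  intro ω ω' hω
  funext i
  exact embIdx_injective hN hNv (congrFun hω i)

/-- The action preserves the number of points of a tuple. [folklore] -/
theorem card_suppP_act (σ τ : Equiv.Perm (Fin v)) (x : Fin j → Idx v h) :
    (suppP (fun i => act σ τ (x i))).card = (suppP x).card := by
  rw [suppP_act, card_image_of_injective _ σ.injective]

/-- The action preserves the number of lines of a tuple. [folklore] -/
theorem card_suppL_act (σ τ : Equiv.Perm (Fin v)) (x : Fin j → Idx v h) :
    (suppL (fun i => act σ τ (x i))).card = (suppL x).card := by
  rw [suppL_act, card_image_of_injective _ τ.injective]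

/-- The embedding preserves the number of points of a tuple. [folklore] -/
theorem card_suppP_emb (hNv : N ≤ v) (ω : Fin j → Idx N h) :
    (suppP (fun i => embIdx hNv (ω i))).card = (suppP ω).card := by
  rw [suppP_emb, card_image_of_injective _ (emb_injective hNv)]

/-- The embedding preserves the number of lines of a tuple. [folklore] -/
theorem card_suppL_emb (hNv : N ≤ v) (ω : Fin j → Idx N h) :
    (suppL (fun i => embIdx hNv (ω i))).card = (suppL ω).card := by
  rw [suppL_emb, card_image_of_injective _ (emb_injective hNv)]

/-- The action preserves the number of points of a tuple. [folklore] -/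
theorem card_suppP_actT (g : Equiv.Perm (Fin v) × Equiv.Perm (Fin v)) (x : Fin j → Idx v h) :
    (suppP (actT g x)).card = (suppP x).card :=
  card_suppP_act g.1 g.2 x

/-- The action preserves the number of lines of a tuple. [folklore] -/
theorem card_suppL_actT (g : Equiv.Perm (Fin v) × Equiv.Perm (Fin v)) (x : Fin j → Idx v h) :
    (suppL (actT g x)).card = (suppL x).card :=
  card_suppL_act g.1 g.2 x

/-- The embedding preserves the number of points of a tuple. [folklore] -/
theorem card_suppP_embT (hNv : N ≤ v) (ω : Fin j → Idx N h) :
    (suppP (embT hNv ω)).card = (suppP ω).card :=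
  card_suppP_emb hNv ω

/-- The embedding preserves the number of lines of a tuple. [folklore] -/
theorem card_suppL_embT (hNv : N ≤ v) (ω : Fin j → Idx N h) :
    (suppL (embT hNv ω)).card = (suppL ω).card :=
  card_suppL_emb hNv ω

/-- A board tuple is an embedded template tuple iff all its points and lines lie in the grid.
[folklore] -/
theorem exists_emb_eq_iff (hN : 0 < N) (hNv : N ≤ v) (y : Fin j → Idx v h) :
    (∃ ω : Fin j → Idx N h, (fun i => embIdx hNv (ω i)) = y) ↔
      suppP y ⊆ gridSet hNv ∧ suppL y ⊆ gridSet hNv := by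
  constructor
  · rintro ⟨ω, rfl⟩
    rw [suppP_emb, suppL_emb]
    constructor
    · intro p hp
      obtain ⟨p', _, rfl⟩ := mem_image.1 hp
      exact mem_image_of_mem _ (mem_univ _)
    · intro q hq
      obtain ⟨q', _, rfl⟩ := mem_image.1 hq
      exact mem_image_of_mem _ (mem_univ _)
  · rintro ⟨hP, hL⟩
    have hPi : ∀ i, pts (y i).1 ⊆ gridSet hNv := fun i =>
      (subset_biUnion_of_mem (fun i => pts (y i).1) (mem_univ i)).trans hP
    have hLi : ∀ i, lns (y i).1 ⊆ gridSet hNv := fun i =>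
      (subset_biUnion_of_mem (fun i => lns (y i).1) (mem_univ i)).trans hL
    refine ⟨fun i => ⟨rel (down hN) (down hN) (y i).1, ?_⟩, ?_⟩
    · rw [card_rel (injOn_down hN hNv (hPi i)) (injOn_down hN hNv (hLi i))]
      exact (y i).2
    · funext i
      apply Subtype.ext
      simp only [embIdx_val]
      exact rel_emb_down hN hNv (hPi i) (hLi i)

/-! ### Counting -/

/-- `κ(a) = C(N,a) · a! · (v - a)!`: the number of permutations of the `v` points moving a given
`a`-set into the `N`-point grid. [folklore] -/
def kappa (v N a : ℕ) : ℕ :=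
  N.choose a * (a.factorial * (v - a).factorial)

/-- `κ(a) > 0` for `a ≤ N`. [folklore] -/
theorem kappa_pos {a : ℕ} (ha : a ≤ N) : 0 < kappa v N a :=
  Nat.mul_pos (Nat.choose_pos ha) (Nat.mul_pos (Nat.factorial_pos _) (Nat.factorial_pos _))

/-- `v! / κ(a) = C(v,a) / C(N,a)` for `a ≤ N ≤ v`. [folklore] -/
theorem factorial_div_kappa {a : ℕ} (ha : a ≤ N) (hNv : N ≤ v) :
    (v.factorial : ℝ) / kappa v N a = (v.choose a : ℝ) / N.choose a := by
  have hav : a ≤ v := ha.trans hNv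
  have hv : (v.factorial : ℝ) = v.choose a * (a.factorial * (v - a).factorial) := by
    rw [← Nat.choose_mul_factorial_mul_factorial hav]; push_cast; ring
  rw [hv, kappa]
  push_cast
  have h1 : (a.factorial : ℝ) ≠ 0 := by positivity
  have h2 : ((v - a).factorial : ℝ) ≠ 0 := by positivity
  have h3 : (N.choose a : ℝ) ≠ 0 := by
    have := Nat.choose_pos ha
    positivity
  field_simp

/-- The number of permutations `σ` with `σ⁻¹` moving `A` into the grid is `κ(|A|)`. [folklore] -/
theorem card_perm_image_symm_subset (hNv : N ≤ v) (A : Finset (Fin v)) :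
    (univ.filter fun σ : Equiv.Perm (Fin v) => A.image ⇑σ⁻¹ ⊆ gridSet hNv).card =
      kappa v N A.card := by
  have h := card_perm_image_subset A (gridSet hNv)
  rw [card_gridSet, Fintype.card_fin] at h
  unfold kappa
  rw [← h]
  refine card_bij (fun σ _ => σ⁻¹) (fun σ hσ => ?_) (fun σ _ σ' _ hσσ' => inv_injective hσσ')
    (fun σ hσ => ⟨σ⁻¹, ?_, inv_inv σ⟩)
  · simpa only [mem_filter, mem_univ, true_and] using hσ
  · simpa only [mem_filter, mem_univ, true_and, inv_inv] using hσ

/-! ### The template-sum formula -/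

/-- The weight of a template tuple with `a` points and `b` lines:
`(C(v,a) / C(N,a)) · (C(v,b) / C(N,b))`, a polynomial in `v`. [folklore] -/
def tsWeight (v N a b : ℕ) : ℝ :=
  ((v.choose a : ℝ) / N.choose a) * ((v.choose b : ℝ) / N.choose b)

/-- **Template-sum formula.** For a function of `j`-tuples of board configurations with at most
`h` cells each, invariant under the board symmetry group, and `j h ≤ N ≤ v`, `0 < N`:
`Σ_x F x = Σ_ω F (ι ω) · tsWeight v N a_ω b_ω` over template tuples `ω`. [folklore] -/
theorem sum_eq_templateSum (hN : 0 < N) (hNv : N ≤ v) (hjh : j * h ≤ N)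
    (F : (Fin j → Idx v h) → ℝ)
    (hF : ∀ (σ τ : Equiv.Perm (Fin v)) (x : Fin j → Idx v h), F (fun i => act σ τ (x i)) = F x) :
    ∑ x : Fin j → Idx v h, F x =
      ∑ ω : Fin j → Idx N h, F (embT hNv ω) * tsWeight v N (suppP ω).card (suppL ω).card := by
  classical
  -- the double sum is over `G × Ω`, with `π (g, ω) = g · ι ω`
  let π : (Equiv.Perm (Fin v) × Equiv.Perm (Fin v)) × (Fin j → Idx N h) → (Fin j → Idx v h) :=
    fun q => actT q.1 (embT hNv q.2)
  -- weights
  let cX : (Fin j → Idx v h) → ℝ := fun x =>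
    1 / ((kappa v N (suppP x).card : ℝ) * kappa v N (suppL x).card)
  let c : (Fin j → Idx N h) → ℝ := fun ω => cX (embT hNv ω)
  have hcX_act : ∀ (g : Equiv.Perm (Fin v) × Equiv.Perm (Fin v)) x, cX (actT g x) = cX x := by
    intro g x
    simp only [cX, card_suppP_actT, card_suppL_actT]
  have hF' : ∀ (g : Equiv.Perm (Fin v) × Equiv.Perm (Fin v)) x, F (actT g x) = F x :=
    fun g x => hF g.1 g.2 x
  -- (A) the double sum, computed over `g` first
  have hA : ∑ q : (Equiv.Perm (Fin v) × Equiv.Perm (Fin v)) × (Fin j → Idx N h), F (π q) * c q.2 =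
      (Fintype.card (Equiv.Perm (Fin v) × Equiv.Perm (Fin v)) : ℝ) *
        ∑ ω, F (embT hNv ω) * c ω := by
    have : ∀ q : (Equiv.Perm (Fin v) × Equiv.Perm (Fin v)) × (Fin j → Idx N h),
        F (π q) * c q.2 = F (embT hNv q.2) * c q.2 := by
      intro q; simp only [π, hF']
    rw [Fintype.sum_congr _ _ this, Fintype.sum_prod_type]
    simp only [sum_const, card_univ, nsmul_eq_mul]
  -- (B) the double sum, computed over the board tuple `π q` first: each fibre contributes `F x`
  have hfib : ∀ x : Fin j → Idx v h,
      ∑ q ∈ univ.filter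
        (fun q : (Equiv.Perm (Fin v) × Equiv.Perm (Fin v)) × (Fin j → Idx N h) => π q = x),
          F (π q) * c q.2 = F x := by
    intro x
    -- on the fibre the summand is constant
    have hconst : ∀ q ∈ univ.filter
        (fun q : (Equiv.Perm (Fin v) × Equiv.Perm (Fin v)) × (Fin j → Idx N h) => π q = x),
        F (π q) * c q.2 = F x * cX x := by
      intro q hq
      have hqx : π q = x := (mem_filter.1 hq).2
      have : c q.2 = cX x := by
        simp only [c]
        rw [← hqx]
        exact (hcX_act q.1 (embT hNv q.2)).symm
      rw [hqx, this]
    rw [sum_congr rfl hconst, sum_const, nsmul_eq_mul]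
    -- the size of the fibre: project to the group
    have hinj : Set.InjOn
        (fun q : (Equiv.Perm (Fin v) × Equiv.Perm (Fin v)) × (Fin j → Idx N h) => q.1)
        (univ.filter (fun q : (Equiv.Perm (Fin v) × Equiv.Perm (Fin v)) × (Fin j → Idx N h) =>
          π q = x) : Finset _) := by
      intro q hq q' hq' hqq'
      simp only [coe_filter, mem_univ, true_and, Set.mem_setOf_eq] at hq hq'
      have e1 : actT q.1 (embT hNv q.2) = x := hq
      have e2 : actT q'.1 (embT hNv q'.2) = x := hq'
      have hfst : q.1 = q'.1 := hqq'
      ext1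
      · exact hfst
      · have h1 : actT q.1 (embT hNv q.2) = actT q.1 (embT hNv q'.2) := by rw [e1, ← e2, hfst]
        have h2 : embT hNv q.2 = embT hNv q'.2 := by
          have := congrArg (actT q.1⁻¹) h1
          rwa [actT_inv_actT, actT_inv_actT] at this
        exact embT_injective hN hNv h2
    have himage : (univ.filter
        (fun q : (Equiv.Perm (Fin v) × Equiv.Perm (Fin v)) × (Fin j → Idx N h) => π q = x)).image
          (fun q => q.1) =
        univ.filter (fun g : Equiv.Perm (Fin v) × Equiv.Perm (Fin v) =>
          (suppP x).image ⇑g.1⁻¹ ⊆ gridSet hNv ∧ (suppL x).image ⇑g.2⁻¹ ⊆ gridSet hNv) := by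
      ext g
      simp only [mem_image, mem_filter, mem_univ, true_and]
      constructor
      · rintro ⟨q, hq, rfl⟩
        have e1 : actT q.1 (embT hNv q.2) = x := hq
        have hy : actT q.1⁻¹ x = embT hNv q.2 := by rw [← e1, actT_inv_actT]
        have := (exists_emb_eq_iff hN hNv (actT q.1⁻¹ x)).1 ⟨q.2, hy.symm⟩
        rwa [show actT q.1⁻¹ x = fun i => act (q.1.1⁻¹) (q.1.2⁻¹) (x i) from rfl, suppP_act,
          suppL_act] at this
      · intro hg
        have hg' : suppP (actT g⁻¹ x) ⊆ gridSet hNv ∧ suppL (actT g⁻¹ x) ⊆ gridSet hNv := by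
          rwa [show actT g⁻¹ x = fun i => act (g.1⁻¹) (g.2⁻¹) (x i) from rfl, suppP_act,
            suppL_act]
        obtain ⟨ω, hω⟩ := (exists_emb_eq_iff hN hNv (actT g⁻¹ x)).2 hg'
        refine ⟨(g, ω), ?_, rfl⟩
        show actT g (embT hNv ω) = x
        rw [show embT hNv ω = actT g⁻¹ x from hω, actT_actT_inv]
    have hcard : ((univ.filter
        (fun q : (Equiv.Perm (Fin v) × Equiv.Perm (Fin v)) × (Fin j → Idx N h) =>
          π q = x)).card : ℝ) =
        (kappa v N (suppP x).card : ℝ) * kappa v N (suppL x).card := by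
      rw [← card_image_of_injOn hinj, himage]
      have hsplit : (univ.filter fun g : Equiv.Perm (Fin v) × Equiv.Perm (Fin v) =>
            (suppP x).image ⇑g.1⁻¹ ⊆ gridSet hNv ∧ (suppL x).image ⇑g.2⁻¹ ⊆ gridSet hNv) =
          (univ.filter fun σ : Equiv.Perm (Fin v) => (suppP x).image ⇑σ⁻¹ ⊆ gridSet hNv) ×ˢ
            (univ.filter fun τ : Equiv.Perm (Fin v) => (suppL x).image ⇑τ⁻¹ ⊆ gridSet hNv) := by
        ext g
        simp only [mem_filter, mem_univ, true_and, mem_product]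
      rw [hsplit, card_product, card_perm_image_symm_subset hNv, card_perm_image_symm_subset hNv]
      push_cast
      ring
    rw [hcard]
    have hκ1 : (kappa v N (suppP x).card : ℝ) ≠ 0 :=
      Nat.cast_ne_zero.2 (kappa_pos ((card_suppP_le x).trans hjh)).ne'
    have hκ2 : (kappa v N (suppL x).card : ℝ) ≠ 0 :=
      Nat.cast_ne_zero.2 (kappa_pos ((card_suppL_le x).trans hjh)).ne'
    simp only [cX]
    field_simp
  have hB : ∑ q : (Equiv.Perm (Fin v) × Equiv.Perm (Fin v)) × (Fin j → Idx N h),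
      F (π q) * c q.2 = ∑ x : Fin j → Idx v h, F x := by
    rw [← sum_fiberwise_of_maps_to (g := π) (fun q _ => mem_univ (π q))]
    exact sum_congr rfl fun x _ => hfib x
  -- combine
  rw [← hB, hA, mul_sum]
  refine sum_congr rfl fun ω _ => ?_
  have hGcard : (Fintype.card (Equiv.Perm (Fin v) × Equiv.Perm (Fin v)) : ℝ) =
      (v.factorial : ℝ) * v.factorial := by
    rw [Fintype.card_prod, Fintype.card_perm, Fintype.card_fin]; push_cast; ring
  rw [hGcard, tsWeight, ← factorial_div_kappa ((card_suppP_le ω).trans hjh) hNv,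
    ← factorial_div_kappa ((card_suppL_le ω).trans hjh) hNv]
  simp only [c, cX, card_suppP_embT, card_suppL_embT]
  ring

end Summit.PneNP.PneNP.Theorems.SosBlindPlanes
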